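import Literature.Geometry.Riemannian.SobolevClosedManifold
import HarnessLib

/-!
# Nash's inequality on a closed Riemannian manifold
# `‖w‖₂^{2+4/n} ≤ ‖w‖₁^{4/n} (A ‖∇w‖₂² + B ‖w‖₂²)`, `n = dim M ≥ 3`

For a smooth Riemannian metric `g` on a compact manifold `M` of dimension `n ≥ 3` (modelled on
any finite-dimensional real normed space, boundaryless model; volume `Vol_g = g.riemVolume`,
gradient square `|∇w|²_g = g.gradSq w = g⁻¹(dw, dw)`), we PROVE

* `exists_nash_const` — **Nash's inequality**: there are constants `A, B ≥ 0` (depending on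
  `(M, g)` only) such that for every `w ∈ C¹(M)`
  `(∫ w² dV_g)^{1 + 2/n} ≤ (∫ |w| dV_g)^{4/n} · (A ∫ |∇w|²_g dV_g + B ∫ w² dV_g)`,
  i.e. `‖w‖₂^{2 + 4/n} ≤ ‖w‖₁^{4/n} (A ‖∇w‖₂² + B ‖w‖₂²)` (real powers `Real.rpow`, real Bochner
  integrals; all of them are finite since `w ∈ C¹` on the compact `M`). This is the input of
  Nash's argument (Nash 1958) for the on-diagonal heat kernel bound `K ≤ C τ^{-n/2}`;
* `integral_sq_le_rpow_integral_abs_mul` — the Hölder interpolation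
  `∫ w² ≤ (∫ |w|)^{4/(n+2)} (∫ |w|^{2n/(n-2)})^{(n-2)/(n+2)}` for a continuous function on a
  compact space with a finite measure (`‖w‖₂ ≤ ‖w‖₁^θ ‖w‖_{2n/(n-2)}^{1-θ}`, `θ = 2/(n+2)`);
* `exists_rpow_integral_abs_rpow_le` — the real-valued form of the tree's Sobolev inequality
  (`exists_sobolev_const` of `SobolevClosedManifold.lean` with `p = 2`, `p' = 2n/(n-2)`):
  `(∫ |w|^{2n/(n-2)})^{(n-2)/(2n)} ≤ A₀ √(∫ |∇w|²_g) + B₀ √(∫ w²)` for `w ∈ C¹(M)`.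

Proof of Nash's inequality: Hölder with the conjugate exponents `(n+2)/4`, `(n+2)/(n-2)` gives
`∫ w² = ∫ |w|^{4/(n+2)} |w|^{2n/(n+2)} ≤ (∫ |w|)^{4/(n+2)} (∫ |w|^{2n/(n-2)})^{(n-2)/(n+2)}`; the
second factor is `(‖w‖_{2n/(n-2)})^{2n/(n+2)} ≤ (A₀ ‖∇w‖₂ + B₀ ‖w‖₂)^{2n/(n+2)}` by Sobolev;
raising to the power `(n+2)/n` and using `(A₀ a + B₀ b)² ≤ 2 (A₀² a² + B₀² b²)` gives the claim
with `A = 2A₀²`, `B = 2B₀²` (`rpow_le_rpow_mul_of_holder_of_sobolev`, pure real algebra).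
Everything is proved; no definitions, no named facts. The degenerate case `∫ |w| = 0` needs no
separate treatment (no division by `‖w‖₁` occurs).

## References

* J. Nash, *Continuity of solutions of parabolic and elliptic equations*, Amer. J. Math. 80
  (1958), 931–954.
* E. B. Davies, *Heat kernels and spectral theory*, Cambridge Tracts in Math. 92, CUP 1989,
  §2.4 (Sobolev and Nash inequalities, ultracontractivity). [Davies1989]
* P. Topping, *Lectures on the Ricci flow*, LMS Lecture Note Series 325, CUP 2006, §8.1 (the
  Sobolev inequality on a closed manifold). [Topping2006]
-/

noncomputable section

open Bundle Set Function Filter Manifold MeasureTheory Metric Module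
open scoped Manifold ContDiff Topology ENNReal NNReal

namespace Literature.Geometry.Riemannian

open Lorentzian

/-! ### Real algebra: from Hölder and Sobolev to Nash -/

/-- **The algebra of Nash's inequality.** If `I₂ ≤ I₁^{4/(N+2)} I_q^{(N-2)/(N+2)}` (Hölder) and
`I_q^{(N-2)/(2N)} ≤ A₀ √I_G + B₀ √I₂` (Sobolev), all quantities nonnegative and `N ≥ 3`, then
`I₂^{1+2/N} ≤ I₁^{4/N} (2A₀² I_G + 2B₀² I₂)`. (Here `I₁ = ∫|w|`, `I₂ = ∫w²`,
`I_q = ∫|w|^{2N/(N-2)}`, `I_G = ∫|∇w|²`.) [folklore] -/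
theorem rpow_le_rpow_mul_of_holder_of_sobolev {N I₁ I₂ Iq IG A₀ B₀ : ℝ} (hN : 3 ≤ N)
    (hI₁ : 0 ≤ I₁) (hI₂ : 0 ≤ I₂) (hIq : 0 ≤ Iq) (hIG : 0 ≤ IG) (hA : 0 ≤ A₀) (hB : 0 ≤ B₀)
    (hH : I₂ ≤ I₁ ^ (4 / (N + 2)) * Iq ^ ((N - 2) / (N + 2)))
    (hS : Iq ^ ((N - 2) / (2 * N)) ≤ A₀ * Real.sqrt IG + B₀ * Real.sqrt I₂) :
    I₂ ^ (1 + 2 / N) ≤ I₁ ^ (4 / N) * (2 * A₀ ^ 2 * IG + 2 * B₀ ^ 2 * I₂) := by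
  have hN0 : N ≠ 0 := by positivity
  have hNp : N + 2 ≠ 0 := by positivity
  have hNpos : 0 < N := by positivity
  set S := A₀ * Real.sqrt IG + B₀ * Real.sqrt I₂ with hSdef
  have hS0 : 0 ≤ S := by positivity
  have hb0 : 0 ≤ 2 * N / (N + 2) := by positivity
  -- Step 1: `I_q^{(N-2)/(N+2)} ≤ S^{2N/(N+2)}`
  have h1 : Iq ^ ((N - 2) / (N + 2)) ≤ S ^ (2 * N / (N + 2)) := by
    have : Iq ^ ((N - 2) / (N + 2)) = (Iq ^ ((N - 2) / (2 * N))) ^ (2 * N / (N + 2)) := by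
      rw [← Real.rpow_mul hIq]
      congr 1
      field_simp
    rw [this]
    exact Real.rpow_le_rpow (Real.rpow_nonneg hIq _) hS hb0
  -- Step 2: `I₂ ≤ I₁^{4/(N+2)} S^{2N/(N+2)}`
  have h2 : I₂ ≤ I₁ ^ (4 / (N + 2)) * S ^ (2 * N / (N + 2)) :=
    hH.trans (mul_le_mul_of_nonneg_left h1 (Real.rpow_nonneg hI₁ _))
  -- Step 3: raise to the power `(N+2)/N`
  have h3 : I₂ ^ ((N + 2) / N) ≤ I₁ ^ (4 / N) * S ^ 2 := by
    calc I₂ ^ ((N + 2) / N) ≤ (I₁ ^ (4 / (N + 2)) * S ^ (2 * N / (N + 2))) ^ ((N + 2) / N) :=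
          Real.rpow_le_rpow hI₂ h2 (by positivity)
      _ = I₁ ^ (4 / N) * S ^ 2 := by
          rw [Real.mul_rpow (Real.rpow_nonneg hI₁ _) (Real.rpow_nonneg hS0 _), ← Real.rpow_mul hI₁,
            ← Real.rpow_mul hS0]
          have e1 : 4 / (N + 2) * ((N + 2) / N) = 4 / N := by field_simp
          have e2 : 2 * N / (N + 2) * ((N + 2) / N) = 2 := by field_simp
          rw [e1, e2, Real.rpow_two]
  -- Step 4: `S² ≤ 2 (A₀² I_G + B₀² I₂)`
  have h4 : S ^ 2 ≤ 2 * A₀ ^ 2 * IG + 2 * B₀ ^ 2 * I₂ := by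
    have key : (A₀ * Real.sqrt IG + B₀ * Real.sqrt I₂) ^ 2 ≤
        2 * A₀ ^ 2 * Real.sqrt IG ^ 2 + 2 * B₀ ^ 2 * Real.sqrt I₂ ^ 2 := by
      nlinarith [sq_nonneg (A₀ * Real.sqrt IG - B₀ * Real.sqrt I₂)]
    rwa [Real.sq_sqrt hIG, Real.sq_sqrt hI₂] at key
  -- conclusion
  calc I₂ ^ (1 + 2 / N) = I₂ ^ ((N + 2) / N) := by rw [add_div, div_self hN0]
    _ ≤ I₁ ^ (4 / N) * S ^ 2 := h3
    _ ≤ I₁ ^ (4 / N) * (2 * A₀ ^ 2 * IG + 2 * B₀ ^ 2 * I₂) :=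
        mul_le_mul_of_nonneg_left h4 (Real.rpow_nonneg hI₁ _)

/-! ### Hölder interpolation `‖w‖₂² ≤ ‖w‖₁^{4/(n+2)} ‖w‖_{2n/(n-2)}^{2n/(n+2)}` -/

/-- **Hölder interpolation between `L¹` and `L^{2N/(N-2)}`**: for a continuous function `w` on a
compact space with a finite measure and a real `N > 2`,
`∫ w² ≤ (∫ |w|)^{4/(N+2)} · (∫ |w|^{2N/(N-2)})^{(N-2)/(N+2)}`
(Hölder's inequality for `|w|^{4/(N+2)} · |w|^{2N/(N+2)}` with the conjugate exponents
`(N+2)/4` and `(N+2)/(N-2)`; equivalently `‖w‖₂ ≤ ‖w‖₁^θ ‖w‖_{2N/(N-2)}^{1-θ}`, `θ = 2/(N+2)`).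
[folklore] -/
theorem integral_sq_le_rpow_integral_abs_mul {α : Type*} [TopologicalSpace α] [CompactSpace α]
    [MeasurableSpace α] [OpensMeasurableSpace α] {μ : Measure α} [IsFiniteMeasure μ]
    {w : α → ℝ} (hw : Continuous w) {N : ℝ} (hN : 2 < N) :
    ∫ x, w x ^ 2 ∂μ ≤ (∫ x, |w x| ∂μ) ^ (4 / (N + 2)) *
      (∫ x, |w x| ^ (2 * N / (N - 2)) ∂μ) ^ ((N - 2) / (N + 2)) := by
  have hN2 : 0 < N - 2 := sub_pos.2 hN
  have hN2' : N - 2 ≠ 0 := hN2.ne'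
  have hNp : 0 < N + 2 := by linarith
  have hNp' : N + 2 ≠ 0 := hNp.ne'
  have hN0 : 0 < N := by linarith
  have ha0 : 0 ≤ 4 / (N + 2) := by positivity
  have hb0 : 0 ≤ 2 * N / (N + 2) := by positivity
  have hpq : ((N + 2) / 4).HolderConjugate ((N + 2) / (N - 2)) := by
    rw [Real.holderConjugate_iff]
    refine ⟨?_, ?_⟩
    · rw [lt_div_iff₀ (by norm_num : (0 : ℝ) < 4)]
      linarith
    · field_simp
      ring
  have hmem : ∀ {f : α → ℝ}, Continuous f → ∀ p : ℝ≥0∞, MemLp f p μ := fun hf _ ↦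
    hf.memLp_of_hasCompactSupport (HasCompactSupport.of_compactSpace _)
  have hca : Continuous fun x ↦ |w x| ^ (4 / (N + 2)) := hw.abs.rpow_const fun _ ↦ Or.inr ha0
  have hcb : Continuous fun x ↦ |w x| ^ (2 * N / (N + 2)) :=
    hw.abs.rpow_const fun _ ↦ Or.inr hb0
  have hH := integral_mul_le_Lp_mul_Lq_of_nonneg (μ := μ) hpq
    (ae_of_all _ fun x ↦ Real.rpow_nonneg (abs_nonneg (w x)) (4 / (N + 2)))
    (ae_of_all _ fun x ↦ Real.rpow_nonneg (abs_nonneg (w x)) (2 * N / (N + 2)))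
    (hmem hca _) (hmem hcb _)
  have hab : ∀ x, |w x| ^ (4 / (N + 2)) * |w x| ^ (2 * N / (N + 2)) = w x ^ 2 := fun x ↦ by
    rw [← Real.rpow_add_of_nonneg (abs_nonneg _) ha0 hb0,
      show 4 / (N + 2) + 2 * N / (N + 2) = 2 by field_simp; ring, Real.rpow_two, sq_abs]
  have hap : ∀ x, (|w x| ^ (4 / (N + 2))) ^ ((N + 2) / 4) = |w x| := fun x ↦ by
    rw [← Real.rpow_mul (abs_nonneg _), show 4 / (N + 2) * ((N + 2) / 4) = 1 by field_simp,
      Real.rpow_one]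
  have hbp : ∀ x, (|w x| ^ (2 * N / (N + 2))) ^ ((N + 2) / (N - 2)) =
      |w x| ^ (2 * N / (N - 2)) := fun x ↦ by
    rw [← Real.rpow_mul (abs_nonneg _)]
    congr 1
    field_simp
  simp only [hab, hap, hbp, one_div_div] at hH
  exact hH

/-! ### The Sobolev inequality with `p = 2` in real-valued form -/

section Nash

variable {E : Type*} [NormedAddCommGroup E] [NormedSpace ℝ E] [FiniteDimensional ℝ E]
  {H : Type*} [TopologicalSpace H] {I : ModelWithCorners ℝ E H} [I.Boundaryless]
  {M : Type*} [TopologicalSpace M] [T2Space M] [CompactSpace M] [ChartedSpace H M]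
  [IsManifold I ∞ M] [MeasurableSpace M] [BorelSpace M]
  (g : PseudoRiemannianMetric I ∞ E (TangentSpace I : M → Type _))

omit [I.Boundaryless] [T2Space M] [CompactSpace M] [MeasurableSpace M] [BorelSpace M] in
/-- `|∇ψ|²_g = g(♯dψ, ♯dψ) ≥ 0` for a Riemannian metric. [folklore] -/
private theorem gradSq_nonneg_of_isRiemannian (hg : g.IsRiemannian) (ψ : M → ℝ) (x : M) :
    0 ≤ g.gradSq ψ x := by
  rw [PseudoRiemannianMetric.gradSq, PseudoRiemannianMetric.innerDual_eq_val_sharp_sharp]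
  by_cases h : g.sharp x (mvfderiv I ψ x : TangentSpace I x →ₗ[ℝ] ℝ) = 0
  · rw [h]; simp
  · exact (hg x _ h).le

omit [I.Boundaryless] in
/-- **The volume of a closed Riemannian manifold is finite** (Federer 1969, §3.2.46), as an
`IsFiniteMeasure` instance term for `Vol_g`; also in the junk case. [folklore] -/
private theorem isFiniteMeasure_riemVolume : IsFiniteMeasure g.riemVolume := by
  refine ⟨?_⟩
  by_cases hg : g.IsRiemannian
  · rw [PseudoRiemannianMetric.riemVolume_eq hg]
    exact riemannianVolume_lt_top_of_isCompact_holds (g.toContMDiffRiemannianMetric hg) le_rfl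
      isCompact_univ
  · simp [PseudoRiemannianMetric.riemVolume, hg]

/-- **The Sobolev inequality `p = 2` on a closed Riemannian manifold, real-valued form**: for
`g` Riemannian on a compact manifold of dimension `n ≥ 3` (`N = n` as a real number) there are
`A₀, B₀ ≥ 0` with, for every `w ∈ C¹(M)`,
`(∫ |w|^{2N/(N-2)} dV_g)^{(N-2)/(2N)} ≤ A₀ √(∫ |∇w|²_g dV_g) + B₀ √(∫ w² dV_g)`,
i.e. `‖w‖_{L^{2n/(n-2)}} ≤ A₀ ‖ |∇w|_g ‖_{L²} + B₀ ‖w‖_{L²}` (`exists_sobolev_const`, the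
`eLpNorm`s of the continuous functions `w`, `|∇w|_g` on the compact `M` being finite and equal to
the corresponding real integrals). [cite: Topping2006, §8.1, proof of Lemma 8.1.8] -/
theorem exists_rpow_integral_abs_rpow_le (hg : g.IsRiemannian) (hn : 3 ≤ finrank ℝ E) {N : ℝ}
    (hN : (finrank ℝ E : ℝ) = N) :
    ∃ A₀ B₀ : ℝ≥0, ∀ w : M → ℝ, ContMDiff I 𝓘(ℝ, ℝ) 1 w →
      (∫ x, |w x| ^ (2 * N / (N - 2)) ∂g.riemVolume) ^ ((N - 2) / (2 * N)) ≤
        A₀ * Real.sqrt (∫ x, g.gradSq w x ∂g.riemVolume) +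
          B₀ * Real.sqrt (∫ x, w x ^ 2 ∂g.riemVolume) := by
  haveI := isFiniteMeasure_riemVolume g
  have hN3 : 3 ≤ N := by rw [← hN]; exact_mod_cast hn
  have hN0 : N ≠ 0 := by positivity
  have hN2 : 0 < N - 2 := by linarith
  have hN2' : N - 2 ≠ 0 := hN2.ne'
  have hNpos : 0 < N := by positivity
  set q₀ : ℝ := 2 * N / (N - 2) with hq₀def
  have hq₀ : 0 < q₀ := div_pos (by positivity) hN2
  set q : ℝ≥0 := ⟨q₀, hq₀.le⟩ with hqdef
  have hqR : (q : ℝ) = q₀ := rfl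
  have hqpos : (0 : ℝ≥0) < q := NNReal.coe_pos.1 (by rw [hqR]; exact hq₀)
  have hpn : ((2 : ℝ≥0) : ℝ) < finrank ℝ E := by
    rw [NNReal.coe_ofNat, hN]
    linarith
  have hp' : (q : ℝ)⁻¹ = ((2 : ℝ≥0) : ℝ)⁻¹ - (finrank ℝ E : ℝ)⁻¹ := by
    rw [hqR, NNReal.coe_ofNat, hN, hq₀def]
    field_simp
  obtain ⟨A₀, B₀, hAB⟩ := exists_sobolev_const g hg (p := 2) (p' := q) one_le_two hpn hp'
  refine ⟨A₀, B₀, fun w hw ↦ ?_⟩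
  have hS := hAB w hw
  have hwc : Continuous w := hw.continuous
  have hG0 : ∀ x, 0 ≤ g.gradSq w x := gradSq_nonneg_of_isRiemannian g hg w
  have hGc : Continuous (g.gradSq w) := continuous_innerDual_mvfderiv g hw hw
  have hmem : ∀ {f : M → ℝ}, Continuous f → ∀ p : ℝ≥0∞, MemLp f p g.riemVolume := fun hf _ ↦
    hf.memLp_of_hasCompactSupport (HasCompactSupport.of_compactSpace _)
  -- the three `eLpNorm`s as real integrals
  have e1 : eLpNorm w (q : ℝ≥0∞) g.riemVolume =
      ENNReal.ofReal ((∫ x, |w x| ^ q₀ ∂g.riemVolume) ^ q₀⁻¹) := by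
    rw [(hmem hwc _).eLpNorm_eq_integral_rpow_norm (ENNReal.coe_ne_zero.2 hqpos.ne')
      ENNReal.coe_ne_top]
    simp only [ENNReal.coe_toReal, hqR, Real.norm_eq_abs]
  have e2 : eLpNorm (fun x ↦ Real.sqrt (g.gradSq w x)) 2 g.riemVolume =
      ENNReal.ofReal (Real.sqrt (∫ x, g.gradSq w x ∂g.riemVolume)) := by
    rw [(hmem hGc.sqrt _).eLpNorm_eq_integral_rpow_norm two_ne_zero ENNReal.ofNat_ne_top,
      Real.sqrt_eq_rpow, one_div, ENNReal.toReal_ofNat]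
    congr 3
    funext x
    rw [Real.norm_of_nonneg (Real.sqrt_nonneg _), Real.rpow_two, Real.sq_sqrt (hG0 x)]
  have e3 : eLpNorm w 2 g.riemVolume =
      ENNReal.ofReal (Real.sqrt (∫ x, w x ^ 2 ∂g.riemVolume)) := by
    rw [(hmem hwc _).eLpNorm_eq_integral_rpow_norm two_ne_zero ENNReal.ofNat_ne_top,
      Real.sqrt_eq_rpow, one_div, ENNReal.toReal_ofNat]
    congr 3
    funext x
    rw [Real.norm_eq_abs, Real.rpow_two, sq_abs]
  have hqinv : q₀⁻¹ = (N - 2) / (2 * N) := by rw [hq₀def, inv_div]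
  rw [ENNReal.coe_ofNat, e1, e2, e3, ← ENNReal.ofReal_coe_nnreal, ← ENNReal.ofReal_coe_nnreal,
    ← ENNReal.ofReal_mul A₀.coe_nonneg, ← ENNReal.ofReal_mul B₀.coe_nonneg,
    ← ENNReal.ofReal_add (by positivity) (by positivity), hqinv] at hS
  exact (ENNReal.ofReal_le_ofReal_iff (by positivity)).1 hS

/-! ### Nash's inequality -/

/-- **Nash's inequality on a closed Riemannian manifold** (Nash 1958; the form fed into Nash's
argument for the heat kernel bound `K ≤ C τ^{-n/2}`, cf. Davies 1989, §2.4). Let `g` be a smooth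
Riemannian metric on a compact manifold `M` of dimension `n ≥ 3`. There are constants `A, B ≥ 0`
such that for every `w ∈ C¹(M)`
`(∫ w² dV_g)^{1 + 2/n} ≤ (∫ |w| dV_g)^{4/n} · (A ∫ |∇w|²_g dV_g + B ∫ w² dV_g)`,
i.e. `‖w‖₂^{2+4/n} ≤ ‖w‖₁^{4/n} (A ‖∇w‖₂² + B ‖w‖₂²)`. Proof: Hölder interpolation
`‖w‖₂ ≤ ‖w‖₁^{2/(n+2)} ‖w‖_{2n/(n-2)}^{n/(n+2)}` (`integral_sq_le_rpow_integral_abs_mul`) and the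
Sobolev inequality `‖w‖_{2n/(n-2)} ≤ A₀ ‖∇w‖₂ + B₀ ‖w‖₂` (`exists_rpow_integral_abs_rpow_le`);
`A = 2A₀²`, `B = 2B₀²`. [folklore] -/
theorem exists_nash_const (hg : g.IsRiemannian) (hn : 3 ≤ finrank ℝ E) :
    ∃ A B : ℝ, 0 ≤ A ∧ 0 ≤ B ∧ ∀ w : M → ℝ, ContMDiff I 𝓘(ℝ, ℝ) 1 w →
      (∫ x, w x ^ 2 ∂g.riemVolume) ^ (1 + 2 / (finrank ℝ E : ℝ)) ≤
        (∫ x, |w x| ∂g.riemVolume) ^ (4 / (finrank ℝ E : ℝ)) *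
          (A * ∫ x, g.gradSq w x ∂g.riemVolume + B * ∫ x, w x ^ 2 ∂g.riemVolume) := by
  haveI := isFiniteMeasure_riemVolume g
  obtain ⟨A₀, B₀, hAB⟩ := exists_rpow_integral_abs_rpow_le g hg hn rfl
  refine ⟨2 * (A₀ : ℝ) ^ 2, 2 * (B₀ : ℝ) ^ 2, by positivity, by positivity, fun w hw ↦ ?_⟩
  have hN3 : (3 : ℝ) ≤ finrank ℝ E := by exact_mod_cast hn
  have hH := integral_sq_le_rpow_integral_abs_mul (μ := g.riemVolume) hw.continuous
    (N := finrank ℝ E) (by linarith)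
  exact rpow_le_rpow_mul_of_holder_of_sobolev hN3 (integral_nonneg fun x ↦ abs_nonneg _)
    (integral_nonneg fun x ↦ sq_nonneg _)
    (integral_nonneg fun x ↦ Real.rpow_nonneg (abs_nonneg _) _)
    (integral_nonneg fun x ↦ gradSq_nonneg_of_isRiemannian g hg w x) A₀.coe_nonneg B₀.coe_nonneg
    hH (hAB w hw)

end Nash

end Literature.Geometry.Riemannian

end
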